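import Summits.Ventures.HSemireg.UntwistComplexLeibnizData
import Summits.Ventures.HSemireg.CocycleExtensionMap
import Summits.Ventures.HSemireg.HomComplexSupertraceTriangle
import HarnessLib

/-!
# Venture HSemireg — route R1.0, complex carriers: the `dlog`-wedge cocycle extension `ext(w) ⊂ F ⊗ –` is the twist
# `F ⊗ R_ω` of the SCALAR cocycle extension (gs-g4 gen 22, brick C7c (i) of `general-structure/COMPLEX-LEIBNIZ-PLAN-gs-g4.md`)

HONEST FRAMING. Module-level and complex-level homological algebra on the tree's REAL carriers: gs-g4's cocycle
extensions `CocycleExtension.ext w` (`CocycleExtension*`), the internal Hom models `F ⊗ G = 𝓗om(F^∨, G)` (`twistG`),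
t-7's `twistShortComplex`. Nothing about any variety; nothing here says HC, HC_CM or HC_AV is proved.

## What is constructed / proved

* `LocalOneCocycle.postcompOf A w` — the post-composed cocycle `ψ ↦ ψ ≫ w_{xy}` on `𝓗om(A, G) → 𝓗om(A, G′)` of a
  local `1`-cocycle `w : G → G′`; `CocycleExtension.toPostcompExt A w : 𝓗om(A, ext w) ⟶ ext (postcompOf A w)`,
  `ψ ↦ (ψ ≫ π, (ψ| ≫ ret_x)_x)`, compatible with `ι`, `π` and natural in `A`.
* `CocycleTwist.dlogScalarCocycle c j : Ωʲ → Ωʲ⁺¹` (`s ↦ (-ω_{xy}) ∧ s`), with `dlogWedgeCocycle c j E =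
  postcompOf (dual E) (dlogScalarCocycle c j)` DEFINITIONALLY; the scalar extension
  `R_j := ext (dlogScalarCocycle c j)` and its short exact sequence `dlogScalarSES c j : 0 → Ωʲ⁺¹ → R_j → Ωʲ → 0`.
* `CocycleTwist.dlogTwistSESHom c j F` — the morphism of short exact sequences of complexes
  `F ⊗ (dlogScalarSES) ⟶ (0 → F ⊗ Ωʲ⁺¹ → extC (dlogWedgeCocycleC c j F) → F ⊗ Ωʲ → 0)` (outer components identities),
  and **`nuClass_eq_triangleOfSESδ_twistShortComplex`**: `ν_j(F) = δ_{F ⊗ dlogScalarSES_j}` — so the class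
  `ν_j = 1 ⊗ [dlog c]` is literally "`F ⊗` (a short exact sequence of MODULES)", the shape to which t-7/gs-g4's trace
  linearity `HomComplexSupertraceTriangle.shiftedHomMap_twistδ_comp_supertrace` applies.

## References

* M. F. Atiyah, Trans. AMS 85 (1957), Prop. 12. [Atiyah1957]
* R. Hartshorne, *Algebraic Geometry* (1977), II Ex. 1.22, III.4. [Hartshorne1977]
-/

noncomputable section

set_option backward.isDefEq.respectTransparency false

open CategoryTheory CategoryTheory.Limits AlgebraicGeometry Opposite TopologicalSpace

namespace Summit.Ventures.HSemireg

open Literature.AlgebraicGeometry.Modules Literature.AlgebraicGeometry.Motives Literature.AlgebraicGeometry.HodgeTheory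
  CocycleTwist Summit.HodgeConjecture.HodgeConjecture.Theorems.PadicPridhamSemiregularity

universe u

variable {S : Type u} [CommRing S] {X : Over (Spec (CommRingCat.of S))} {c : UnitCocycle X.left}

/-! ### Post-composed cocycles and `𝓗om(A, ext w) ⟶ ext (ψ ↦ ψ ≫ w)` -/

namespace LocalOneCocycle

variable (A : X.left.Modules) {G G' : X.left.Modules} (w : LocalOneCocycle c G G')

/-- **The post-composed cocycle** `ψ ↦ ψ ≫ w_{xy}` on `𝓗om(A, G)| → 𝓗om(A, G′)|`. [folklore] -/
def postcompOf : LocalOneCocycle c (sheafHom A G) (sheafHom A G') where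
  w x y V hx hy := postcompOver A (w.w x y V hx hy)
  restrictHom_w x y V W hx hy i := by rw [restrictHom_postcompOver', w.restrictHom_w]
  w_cocycle x y z V hx hy hz := by rw [w.w_cocycle x y z V hx hy hz, postcompOver_add']

/-- Components of the post-composed cocycle. [folklore] -/
@[simp]
theorem postcompOf_w (x y : X.left) (V : X.left.Opens) (hx : V ≤ c.U x) (hy : V ≤ c.U y) :
    (postcompOf A w).w x y V hx hy = postcompOver A (w.w x y V hx hy) := rfl

end LocalOneCocycle

namespace CocycleExtension

variable (A : X.left.Modules) {G G' : X.left.Modules} (w : LocalOneCocycle c G G')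

/-- The section map `ψ ↦ (ψ ≫ π, (ψ|_{V ∩ U_x} ≫ ret_x)_x)`. [folklore] -/
def toPostcompFamily {V : X.left.Opens} (ψ : A.over V ⟶ (ext w).over V) : PairFamily (c := c) (A := sheafHom A G)
    (B := sheafHom A G') V :=
  ((ψ ≫ (SheafOfModules.overFunctor _ V).map (π w) : A.over V ⟶ G.over V),
    fun x => (restrictHom (homOfLE (inf_le_left : V ⊓ c.U x ≤ V)) ψ ≫
      restrictHom (homOfLE (inf_le_right : V ⊓ c.U x ≤ c.U x)) (ret w x) : A.over (V ⊓ c.U x) ⟶ G'.over (V ⊓ c.U x)))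

/-- Restriction of a section of an internal Hom is `restrictHom` (definitional). [folklore] -/
theorem sheafHom_map_eq_restrictHom {B C : X.left.Modules} {V W : X.left.Opens} (h : W ≤ V) (ψ : B.over V ⟶ C.over V) :
    (sheafHom B C).presheaf.map (homOfLE h).op ψ = (restrictHom (homOfLE h) ψ : Γ(sheafHom B C, W)) := rfl

/-- The section map satisfies the gluing relation of the post-composed cocycle (`ret_x - ret_y = π ≫ w_{xy}`).
[folklore] -/
theorem toPostcompFamily_mem {V : X.left.Opens} (ψ : A.over V ⟶ (ext w).over V) :
    toPostcompFamily A w ψ ∈ extFamilies (w.postcompOf A) V := by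
  intro x y W hW hx hy
  change restrictHom (homOfLE (le_inf hW hx)) (restrictHom _ ψ ≫ restrictHom _ (ret w x)) -
      restrictHom (homOfLE (le_inf hW hy)) (restrictHom _ ψ ≫ restrictHom _ (ret w y)) =
    appLE (postcompOver A (w.w x y W hx hy)) (𝟙 W) (restrictHom (homOfLE hW) (ψ ≫ _))
  rw [appLE_postcompOver, restrictHom_id', restrictHom_comp, restrictHom_comp, ← restrictHom_comp', ← restrictHom_comp',
    ← restrictHom_comp', ← restrictHom_comp',
    Subsingleton.elim (homOfLE (le_inf hW hx) ≫ homOfLE (inf_le_left : V ⊓ c.U x ≤ V)) (homOfLE hW),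
    Subsingleton.elim (homOfLE (le_inf hW hy) ≫ homOfLE (inf_le_left : V ⊓ c.U y ≤ V)) (homOfLE hW),
    Subsingleton.elim (homOfLE (le_inf hW hx) ≫ homOfLE (inf_le_right : V ⊓ c.U x ≤ c.U x)) (homOfLE hx),
    Subsingleton.elim (homOfLE (le_inf hW hy) ≫ homOfLE (inf_le_right : V ⊓ c.U y ≤ c.U y)) (homOfLE hy),
    ← Preadditive.comp_sub, ret_sub_ret w x y hx hy, restrictHom_comp, restrictHom_over_map, Category.assoc]
  rfl

/-- The section map is additive. [folklore] -/
theorem toPostcompFamily_add {V : X.left.Opens} (ψ ψ' : A.over V ⟶ (ext w).over V) :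
    toPostcompFamily A w (ψ + ψ') = toPostcompFamily A w ψ + toPostcompFamily A w ψ' :=
  Prod.ext (Preadditive.add_comp _ _ _ _ _ _) (funext fun x => by
    change restrictHom _ (ψ + ψ') ≫ _ = restrictHom _ ψ ≫ _ + restrictHom _ ψ' ≫ _
    rw [restrictHom_add, Preadditive.add_comp])

/-- **`𝓗om(A, ext w) ⟶ ext (ψ ↦ ψ ≫ w)`**, `ψ ↦ (ψ ≫ π, (ψ| ≫ ret_x)_x)`. [cite: Hartshorne1977, II Ex. 1.22] -/
def toPostcompExt : sheafHom A (ext w) ⟶ ext (w.postcompOf A) :=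
  homMk (w.postcompOf A)
    (fun V =>
      { toFun := fun ψ => mk _ (toPostcompFamily A w ψ) (toPostcompFamily_mem A w ψ)
        map_zero' := ext_ext _ (by simp [toPostcompFamily]) fun x => by simp [toPostcompFamily]
        map_add' := fun ψ ψ' => ext_ext _
          (by rw [fst_add, fst_mk, fst_mk, fst_mk, toPostcompFamily_add]; rfl)
          fun x => by rw [comp_add, comp_mk, comp_mk, comp_mk, toPostcompFamily_add]; rfl })
    (fun V W h ψ => by
      change (restrictHom (homOfLE h) ψ ≫ _ : A.over W ⟶ G.over W) = restrictHom (homOfLE h) (ψ ≫ _)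
      rw [restrictHom_comp, restrictHom_over_map])
    (fun V W h ψ x => by
      change restrictHom _ (restrictHom (homOfLE h) ψ) ≫ restrictHom _ (ret w x) =
        restrictHom (homOfLE (inf_le_inf_right (c.U x) h)) (restrictHom _ ψ ≫ restrictHom _ (ret w x))
      rw [restrictHom_comp, ← restrictHom_comp', ← restrictHom_comp', ← restrictHom_comp',
        Subsingleton.elim (homOfLE (inf_le_left : W ⊓ c.U x ≤ W) ≫ homOfLE h)
          (homOfLE (inf_le_inf_right (c.U x) h) ≫ homOfLE (inf_le_left : V ⊓ c.U x ≤ V)),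
        Subsingleton.elim (homOfLE (inf_le_right : W ⊓ c.U x ≤ c.U x))
          (homOfLE (inf_le_inf_right (c.U x) h) ≫ homOfLE (inf_le_right : V ⊓ c.U x ≤ c.U x))])
    (fun V a ψ => by
      change ((a • ψ) ≫ _ : A.over V ⟶ G.over V) = a • (ψ ≫ _)
      rw [smul_comp_overHom])
    (fun V a ψ x => by
      change restrictHom _ (a • ψ) ≫ restrictHom _ (ret w x) = _ • (restrictHom _ ψ ≫ restrictHom _ (ret w x))
      rw [restrictHom_smul, smul_comp_overHom])

/-- `A`-component of `toPostcompExt ψ`: `ψ ≫ π`. [folklore] -/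
@[simp]
theorem fst_toPostcompExt_app {V : X.left.Opens} (ψ : A.over V ⟶ (ext w).over V) :
    fst (w.postcompOf A) ((toPostcompExt A w).app V ψ) =
      (ψ ≫ (SheafOfModules.overFunctor _ V).map (π w) : A.over V ⟶ G.over V) := rfl

/-- Point components of `toPostcompExt ψ`: `ψ| ≫ ret_x|`. [folklore] -/
@[simp]
theorem comp_toPostcompExt_app {V : X.left.Opens} (ψ : A.over V ⟶ (ext w).over V) (x : X.left) :
    comp (w.postcompOf A) ((toPostcompExt A w).app V ψ) x =
      (restrictHom (homOfLE (inf_le_left : V ⊓ c.U x ≤ V)) ψ ≫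
        restrictHom (homOfLE (inf_le_right : V ⊓ c.U x ≤ c.U x)) (ret w x) : A.over (V ⊓ c.U x) ⟶ G'.over (V ⊓ c.U x)) :=
  rfl

/-- Restriction to an open of the zero morphism is zero. [folklore] -/
theorem over_map_zero (E M : X.left.Modules) (V : X.left.Opens) :
    (SheafOfModules.overFunctor _ V).map (0 : E ⟶ M) = 0 :=
  hom_ext_of_appLE fun W k s => by rw [appLE_over_map, appLE_zero, Scheme.Modules.Hom.zero_app]; rfl

/-- **Compatibility with `ι`**: `𝓗om(A, ι) ≫ toPostcompExt = ι` (`ι ≫ π = 0`, `ι| ≫ ret_x = 𝟙`). [folklore] -/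
theorem sheafHomMap_ι_comp_toPostcompExt : sheafHomMap A (ι w) ≫ toPostcompExt A w = ι (w.postcompOf A) := by
  refine Scheme.Modules.hom_ext _ _ fun V => AddCommGrpCat.ext fun (β : A.over V ⟶ G'.over V) => ?_
  change (toPostcompExt A w).app V ((sheafHomMap A (ι w)).app V β) = (ι (w.postcompOf A)).app V β
  refine ext_ext _ ?_ fun x => ?_
  · rw [fst_toPostcompExt_app, fst_ι_app, sheafHomMap_app_apply, Category.assoc, ← Functor.map_comp, ι_comp_π,
      over_map_zero, Limits.comp_zero]
  · rw [comp_toPostcompExt_app, comp_ι_app, sheafHomMap_app_apply, restrictHom_comp, restrictHom_over_map, Category.assoc,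
      ← restrictHom_over_map (homOfLE (inf_le_right : V ⊓ c.U x ≤ c.U x)) (ι w), ← restrictHom_comp, ι_comp_ret,
      restrictHom_id, Category.comp_id]
    rfl

/-- **Compatibility with `π`**: `toPostcompExt ≫ π = 𝓗om(A, π)`. [folklore] -/
theorem toPostcompExt_comp_π : toPostcompExt A w ≫ π (w.postcompOf A) = sheafHomMap A (π w) :=
  Scheme.Modules.hom_ext _ _ fun _ => AddCommGrpCat.ext fun _ => rfl

/-- **Naturality in `A`** (pre-composition): for `g : A′ → A`,
`𝓗om(g, ext w) ≫ toPostcompExt A′ = toPostcompExt A ≫ map (𝓗om(g, G), 𝓗om(g, G′))`. [folklore] -/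
theorem sheafHomPrecomp_comp_toPostcompExt {A' : X.left.Modules} (g : A' ⟶ A)
    (h : ∀ (x y : X.left) (V : X.left.Opens) (hx : V ≤ c.U x) (hy : V ≤ c.U y),
      (SheafOfModules.overFunctor _ V).map (sheafHomPrecomp g G) ≫ (w.postcompOf A').w x y V hx hy =
        (w.postcompOf A).w x y V hx hy ≫ (SheafOfModules.overFunctor _ V).map (sheafHomPrecomp g G')) :
    sheafHomPrecomp g (ext w) ≫ toPostcompExt A' w =
      toPostcompExt A w ≫ map (w.postcompOf A) (w.postcompOf A') (sheafHomPrecomp g G) (sheafHomPrecomp g G') h := by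
  refine Scheme.Modules.hom_ext _ _ fun V => AddCommGrpCat.ext fun (ψ : A.over V ⟶ (ext w).over V) => ?_
  change (toPostcompExt A' w).app V ((sheafHomPrecomp g (ext w)).app V ψ) =
    (map _ _ _ _ h).app V ((toPostcompExt A w).app V ψ)
  refine ext_ext _ ?_ fun x => ?_
  · rw [fst_toPostcompExt_app, fst_map_app, fst_toPostcompExt_app, sheafHomPrecomp_app_apply, sheafHomPrecomp_app_apply,
      Category.assoc]
  · rw [comp_toPostcompExt_app, comp_map_app, comp_toPostcompExt_app, sheafHomPrecomp_app_apply]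
    change restrictHom _ (_ ≫ ψ) ≫ _ = (SheafOfModules.overFunctor _ _).map g ≫ restrictHom _ ψ ≫ _
    rw [restrictHom_comp, restrictHom_over_map, Category.assoc]

end CocycleExtension

/-! ### The scalar `dlog`-wedge cocycle and its extension `R_j` -/

namespace CocycleTwist

variable (c) (j : ℕ)

/-- **The scalar `dlog`-wedge cocycle** `s ↦ (-ω_{xy}) ∧ s : Ωʲ| → Ωʲ⁺¹|`, `ω_{xy} = dlogForm c x y`.
[cite: Atiyah1957, Prop. 12] -/
def dlogScalarCocycle : LocalOneCocycle c (hodgeSheaf X j) (hodgeSheaf X (j + 1)) where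
  w x y V hx hy := wedgeHomAt j (-(dlogForm c x y V hx hy))
  restrictHom_w x y V W hx hy i := by rw [restrictHom_wedgeHomAt, map_neg, map_dlogForm]
  w_cocycle x y z V hx hy hz := by rw [dlogForm_add c x y z V hx hy hz, neg_add, wedgeHomAt_add]

/-- gs-g4's `dlogWedgeCocycle c j E` IS the post-composed scalar cocycle (definitionally). [folklore] -/
theorem dlogWedgeCocycle_eq_postcompOf (E : X.left.Modules) :
    dlogWedgeCocycle c j E = (dlogScalarCocycle c j).postcompOf (dual E) := rfl

/-- **`0 → Ωʲ⁺¹ → R_j → Ωʲ → 0`**, `R_j = ext (dlogScalarCocycle c j)` (the extension with class `[-dlog c] ∧ –`). [folklore] -/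
abbrev dlogScalarSES : ShortComplex X.left.Modules :=
  ShortComplex.mk (CocycleExtension.ι (dlogScalarCocycle c j)) (CocycleExtension.π (dlogScalarCocycle c j))
    (CocycleExtension.ι_comp_π _)

/-- The scalar extension is short exact. [folklore] -/
theorem dlogScalarSES_shortExact : (dlogScalarSES c j).ShortExact := CocycleExtension.shortExact _

variable (F : CochainComplex X.left.Modules ℤ)

/-- The compatibility hypothesis of `map` for pre-composition along `d ⊗ 1` (exchange law). [folklore] -/
theorem compat_precomp_postcompOf {E E' : X.left.Modules} (g : E ⟶ E') (x y : X.left) (V : X.left.Opens)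
    (hx : V ≤ c.U x) (hy : V ≤ c.U y) :
    (SheafOfModules.overFunctor _ V).map (sheafHomPrecomp (sheafHomPrecomp g (unitModule X.left)) (hodgeSheaf X j)) ≫
        ((dlogScalarCocycle c j).postcompOf (dual E')).w x y V hx hy =
      ((dlogScalarCocycle c j).postcompOf (dual E)).w x y V hx hy ≫
        (SheafOfModules.overFunctor _ V).map (sheafHomPrecomp (sheafHomPrecomp g (unitModule X.left)) (hodgeSheaf X (j + 1))) :=
  over_map_sheafHomPrecomp_postcompOver _ _

/-- **`F ⊗ R_j ⟶ extC (dlogWedgeCocycleC c j F)`** termwise `toPostcompExt` (a chain map by naturality in `A`).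
[folklore] -/
def toDlogWedgeExtC :
    HomComplex.twistG X.left (CocycleExtension.ext (dlogScalarCocycle c j)) F ⟶
      CocycleExtension.extC (dlogWedgeCocycleC c j F) where
  f p := CocycleExtension.toPostcompExt (dual (F.X p)) (dlogScalarCocycle c j)
  comm' p p' _ := by
    rw [CocycleExtension.extC_d]
    exact (CocycleExtension.sheafHomPrecomp_comp_toPostcompExt (dual (F.X p)) (dlogScalarCocycle c j)
      (sheafHomPrecomp (F.d p p') (unitModule X.left)) (compat_precomp_postcompOf c j (F.d p p'))).symm

/-- Components of `toDlogWedgeExtC`. [folklore] -/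
@[simp]
theorem toDlogWedgeExtC_f (p : ℤ) :
    (toDlogWedgeExtC c j F).f p = CocycleExtension.toPostcompExt (dual (F.X p)) (dlogScalarCocycle c j) := rfl

/-- **The morphism of short exact sequences `F ⊗ (0 → Ωʲ⁺¹ → R_j → Ωʲ → 0) ⟶ (0 → F ⊗ Ωʲ⁺¹ → extC → F ⊗ Ωʲ → 0)`**
(outer components identities: `twistG X.left Ωᵏ F` and `twistHodgeComplex X k F` are the same complex). [folklore] -/
def dlogTwistSESHom :
    HomComplex.twistShortComplex X.left (dlogScalarSES c j) F ⟶ CocycleExtension.shortComplexC (dlogWedgeCocycleC c j F) where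
  τ₁ := 𝟙 _
  τ₂ := toDlogWedgeExtC c j F
  τ₃ := 𝟙 _
  comm₁₂ := by
    rw [Category.id_comp]
    refine HomologicalComplex.hom_ext _ _ fun p => ?_
    rw [HomologicalComplex.comp_f, toDlogWedgeExtC_f, CocycleExtension.ιC_f]
    exact (CocycleExtension.sheafHomMap_ι_comp_toPostcompExt (dual (F.X p)) (dlogScalarCocycle c j)).symm
  comm₂₃ := by
    rw [Category.comp_id]
    refine HomologicalComplex.hom_ext _ _ fun p => ?_
    rw [HomologicalComplex.comp_f, toDlogWedgeExtC_f, CocycleExtension.πC_f]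
    exact CocycleExtension.toPostcompExt_comp_π (dual (F.X p)) (dlogScalarCocycle c j)

variable [HasDerivedCategory X.left.Modules] (hF : ∀ p, IsFiniteLocallyFree (F.X p))

/-- **`ν_j(F) = δ_{F ⊗ dlogScalarSES_j}`**: the class `ν_j = 1 ⊗ [dlog c]` of `AtiyahNuCommute` is the connecting
morphism of `F ⊗` (a short exact sequence of MODULES). [cite: Atiyah1957, Prop. 12] -/
theorem triangleOfSESδ_twistShortComplex_dlogScalarSES :
    DerivedCategory.triangleOfSESδ (HomComplex.twistShortComplex_shortExact X.left (dlogScalarSES c j) F hF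
        (dlogScalarSES_shortExact c j)) =
      DerivedCategory.triangleOfSESδ (CocycleExtension.shortExactC (dlogWedgeCocycleC c j F)) := by
  have h := DerivedCategory.triangleOfSESδ_naturality
    (HomComplex.twistShortComplex_shortExact X.left (dlogScalarSES c j) F hF (dlogScalarSES_shortExact c j))
    (CocycleExtension.shortExactC (dlogWedgeCocycleC c j F)) (dlogTwistSESHom c j F)
  dsimp only [dlogTwistSESHom] at h
  rw [CategoryTheory.Functor.map_id, CategoryTheory.Functor.map_id, CategoryTheory.Functor.map_id,
    Category.comp_id, Category.id_comp] at h
  exact h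

end CocycleTwist

end Summit.Ventures.HSemireg

end
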